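import Summits.KontsevichZagierPeriods.KontsevichZagierPeriods.Theorems.LinRedNormalFormArrangementNormalFormStubRebaseSimpleZeroManyChainRadialMap
import Summits.KontsevichZagierPeriods.KontsevichZagierPeriods.Theorems.LinRedNormalFormArrangementNormalFormStubRebaseSimpleZeroNestedPinchU

/-!
# Stub `stub_rebaseSimpleZeroMany`, part `rebaseSimpleZeroMany_common` (crux `ArrangementNormalForm`,
line `janus-bands`) — brick `ChainRadial`

**The radial blow-up of a mixed pinch configuration with AT MOST ONE letter off the vertex and
NO letter-free fibre** (worker W4's second chart, any number of fibres). A clean chain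
`A(y) < t₀ < ⋯ < tₙ < B(y)` over the cell `{0 < ε₁ (y − y₀) < ε}` with bounds through the pinch
vertex `(y₀, t₀)`, `0 < ε₁ A'`, simple base pole AT `y₀`, the fibre `k` carrying any constant
letter `c_k` and EVERY other fibre carrying the letter `t₀`, is good for `GG 0 2 (n + 1)`
(`RebaseChain.IsChain.good_radial`): three moves of rule (2),
1. the `Z`-chart `(Y; u) ↦ (y₀ + ε₁ ε Y; t₀ + uₗ Y)` (`RebaseChain.zmap`, Jacobian `ε Y^{n+1}`):
   the integrand becomes `ε₁ K/(∏_{l ≠ k} uₗ · (u_k Y − c'))`, `c' = c_k − t₀`, on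
   `{0 < Y < 1} × {ε₁εA' < u₀ < ⋯ < uₙ < ε₁εB'}`;
2. the swap of the base `Y` with the fibre `u_k =: b` (`RebaseChain.swapIdx`, a reindexing);
3. the fibre blow-up `Z = b Y` (`RebaseZero.fibBlow k 0 0 0`, Jacobian `b`, push-forward form
   `RebaseChain.cov_push`): the integrand becomes the LITERAL `ε₁ K/(b · ∏_{l ≠ k} aₗ · (Z − c'))`
   on the radial pattern `RebaseChain.rlo/rhi` (chain with the base at the position `k`,
   `0 < Z < y`), an element of `GG 0 2 (n + 1)` (`RebasePos.mem_GGset_two`).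
Registered: `rebaseSimpleZeroMany_chainRadial`.

References: M. Kontsevich, D. Zagier, *Periods* (2001), §1.2, rule (2).
-/

noncomputable section

open Set MeasureTheory MvPolynomial
open Literature.NumberTheory.Transcendental Literature.ModelTheory.ExponentialFields

namespace Summit.KontsevichZagierPeriods.ArrangementNormalForm.JanusBands

namespace RebaseChain

open SeparatePos RebasePos RebaseZero RebaseNest

variable {n : ℕ}

/-! ### Algebra of the two charts -/

/-- The power bookkeeping of the scaled `Z`-chart with one letter off the vertex:
`K · 1/(ε₁ ε Y) · (P Y^{−n} Q) · ε Y^{n+1} = ε₁ K P Q`. [folklore] -/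
theorem rchart_powers {Y ε₁ δ : ℝ} (hY : Y ≠ 0) (hδ : δ ≠ 0) (hε : ε₁ * ε₁ = 1) (K P Q : ℝ) (nn : ℕ) :
    K * (1 / (ε₁ * δ * Y)) * (P * (1 / Y) ^ nn * Q) * (δ * Y ^ (nn + 1)) = ε₁ * K * (P * Q) := by
  have hε0 : ε₁ ≠ 0 := fun h0 => by rw [h0, mul_zero] at hε; exact zero_ne_one hε
  have hinv : ε₁⁻¹ = ε₁ := inv_eq_of_mul_eq_one_right hε
  have h1 : (1 / Y) ^ nn * Y ^ (nn + 1) = Y := by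
    rw [one_div_pow, pow_succ, ← mul_assoc, one_div_mul_cancel (pow_ne_zero _ hY), one_mul]
  calc K * (1 / (ε₁ * δ * Y)) * (P * (1 / Y) ^ nn * Q) * (δ * Y ^ (nn + 1))
      = K * (P * Q) * (δ / (ε₁ * δ * Y)) * ((1 / Y) ^ nn * Y ^ (nn + 1)) := by ring
    _ = K * (P * Q) * (ε₁ / Y) * Y := by
        rw [h1]
        congr 2
        rw [div_eq_div_iff (mul_ne_zero (mul_ne_zero hε0 hδ) hY) hY]
        linear_combination (-(δ * Y)) * hε
    _ = ε₁ * K * (P * Q) := by field_simp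

/-- Splitting a product over the fibres at the fibre `k`. [folklore] -/
theorem prod_eq_erase_mul (k : Fin (n + 1)) (g : Fin (n + 1) → ℝ) :
    ∏ l, g l = (∏ l ∈ Finset.univ.erase k, g l) * g k :=
  (Finset.prod_erase_mul _ _ (Finset.mem_univ k)).symm

/-- Pulling a common factor out of the product over the fibres other than `k`. [folklore] -/
theorem prod_erase_one_div_mul (k : Fin (n + 1)) (u : Fin (n + 1) → ℝ) (Y : ℝ) :
    ∏ l ∈ Finset.univ.erase k, 1 / (u l * Y) = (∏ l ∈ Finset.univ.erase k, 1 / u l) * (1 / Y) ^ n := by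
  rw [Finset.prod_congr rfl fun l _ => (one_div_mul_one_div (u l) Y).symm, Finset.prod_mul_distrib,
    Finset.prod_const, Finset.card_erase_of_mem (Finset.mem_univ k), Finset.card_univ, Fintype.card_fin,
    Nat.add_sub_cancel]

/-- The base cell `A < b < B` of the radial chart. [folklore] -/
theorem mem_cellR (αz βz : ℚ) (b : ℝ) :
    b ∈ cell ![RebaseZero.mk 1 (-αz), RebaseZero.mk (-1) βz] ↔ (αz : ℝ) < b ∧ b < βz := by
  simp only [cell, mem_setOf_eq, Fin.forall_fin_two, Matrix.cons_val_zero, Matrix.cons_val_one, ev_mk]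
  push_cast
  constructor <;> rintro ⟨h1, h2⟩ <;> constructor <;> linarith

variable (k : Fin (n + 1))

/-- The fibres after the swap are the radial chain values. -/
theorem tv_swapIdx_eq_xv (v : Fin (0 + 1 + (n + 1)) → ℝ) : tv (fun i => v (swapIdx k i)) = xv k v := by
  funext l
  by_cases hl : l = k
  · subst hl; rw [tv_swapIdx_self, xv, if_pos rfl]
  · rw [tv_swapIdx_of_ne k v hl, xv, if_neg hl]

/-- The fibre blow-up does not change the radial chain values. -/
theorem xv_fibBlow (γ δ p : ℝ) (v : Fin (0 + 1 + (n + 1)) → ℝ) : xv k (fibBlow k γ δ p v) = xv k v := by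
  funext l
  by_cases hl : l = k
  · subst hl; rw [xv, xv, if_pos rfl, if_pos rfl, yv_fibBlow]
  · rw [xv, xv, if_neg hl, if_neg hl, tv_fibBlow_of_ne _ _ _ _ _ hl]

/-- Updating the radial fibre does not change the radial chain values. -/
theorem xv_update (z : Fin (0 + 1 + (n + 1)) → ℝ) (x : ℝ) : xv k (Function.update z (tIdx k) x) = xv k z := by
  funext l
  by_cases hl : l = k
  · subst hl; rw [xv, xv, if_pos rfl, if_pos rfl, yv_update]
  · rw [xv, xv, if_neg hl, if_neg hl, tv_update_of_ne _ hl]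

/-! ### The move -/

variable {m' : ℕ} {s : KZ.IntegralRep (0 + 1 + (n + 1))} {M : Fin m' → Cf} {A Bd : Cf} {T : BData}
  {p : MvPolynomial (Fin 0) ℚ} {a : Fin (n + 1) → Option Cf}

/-- **The radial blow-up of a pinch configuration with at most one letter off the vertex (on the
fibre `k`) and no letter-free fibre is good for `GG 0 2 (n + 1)`.**
[Kontsevich–Zagier 2001, §1.2, rule (2)] -/
theorem IsChain.good_radial (h : IsChain s M A Bd T p a) (y₀ t₀ ε₁ ε : ℚ) (hε₁ : ε₁ = 1 ∨ ε₁ = -1)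
    (hε : 0 < ε) (hcellI : ∀ y : ℝ, y ∈ cell M ↔ 0 < (ε₁ : ℝ) * (y - y₀) ∧ (ε₁ : ℝ) * (y - y₀) < ε)
    (hA0 : A.1 (Fin.last 0) * y₀ + A.2 = t₀) (hB0 : Bd.1 (Fin.last 0) * y₀ + Bd.2 = t₀)
    (hα : 0 < ε₁ * A.1 (Fin.last 0)) (hp : T.ℓ₂.2 = y₀) {ck : Cf} (hk : a k = some ck)
    (hP : ∀ l, l ≠ k → ∃ c, a l = some c ∧ c.2 = t₀) : Good (n + 1) (KZ.of s) := by
  classical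
  -- constants
  have hε2 : (ε₁ : ℝ) * ε₁ = 1 := by rcases hε₁ with rfl | rfl <;> norm_num
  have hεa : |(ε₁ : ℝ)| = 1 := by rcases hε₁ with rfl | rfl <;> norm_num
  have hε0 : (ε₁ : ℝ) ≠ 0 := fun h0 => by rw [h0, mul_zero] at hε2; exact zero_ne_one hε2
  have hεp : (0 : ℝ) < ε := by exact_mod_cast hε
  set α : ℚ := A.1 (Fin.last 0) with hαdef
  set β : ℚ := Bd.1 (Fin.last 0) with hβdef
  set αz : ℚ := ε₁ * α * ε with hαz
  set βz : ℚ := ε₁ * β * ε with hβz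
  have hαz0 : 0 < αz := mul_pos hα hε
  have hαz0' : (0 : ℝ) < αz := by exact_mod_cast hαz0
  set sc : ℚ := ε₁ * ε with hsc
  have hsc' : (sc : ℝ) = ε₁ * ε := by rw [hsc, Rat.cast_mul]
  have hsc0 : (sc : ℝ) ≠ 0 := by rw [hsc']; exact mul_ne_zero hε0 hεp.ne'
  set c' : ℚ := ck.2 - t₀ with hc'
  set q₀ : ℚ := p.coeff 0 / ∏ j, (T.L j).2 ^ T.e j with hq₀
  have hq₀' : (q₀ : ℝ) = ((p.coeff 0 : ℚ) : ℝ) / ∏ j, ((T.L j).2 : ℝ) ^ T.e j := by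
    rw [hq₀]; push_cast; rfl
  have hAv : ∀ Y : ℝ, ev A (y₀ + ε₁ * ε * Y) = t₀ + αz * Y := fun Y => by
    have h1 : (α : ℝ) * y₀ + A.2 = t₀ := by
      have := congrArg (fun q : ℚ => (q : ℝ)) hA0; simp only [Rat.cast_add, Rat.cast_mul] at this; exact this
    rw [ev, hαz, Rat.cast_mul, Rat.cast_mul]; linear_combination h1
  have hBv : ∀ Y : ℝ, ev Bd (y₀ + ε₁ * ε * Y) = t₀ + βz * Y := fun Y => by
    have h1 : (β : ℝ) * y₀ + Bd.2 = t₀ := by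
      have := congrArg (fun q : ℚ => (q : ℝ)) hB0; simp only [Rat.cast_add, Rat.cast_mul] at this; exact this
    rw [ev, hβz, Rat.cast_mul, Rat.cast_mul]; linear_combination h1
  -- the letters: `t₀` on the fibres `l ≠ k`, `c_k` on `k`
  have hprodA : ∀ z : Fin (0 + 1 + (n + 1)) → ℝ, ∏ l, (a l).elim (1 : ℝ) (fun c => 1 / (tv z l - ev c (yv z))) =
      (∏ l ∈ Finset.univ.erase k, 1 / (tv z l - t₀)) * (1 / (tv z k - ck.2)) := by
    intro z
    rw [prod_eq_erase_mul k, hk, Option.elim_some, ev_of_fst_eq_zero (h.a0 k ck hk)]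
    congr 1
    refine Finset.prod_congr rfl fun l hl => ?_
    obtain ⟨c, hc, hct⟩ := hP l (Finset.ne_of_mem_erase hl)
    rw [hc, Option.elim_some, ev_of_fst_eq_zero (h.a0 l c hc), hct]
  ------------------------------------------------------------------
  -- Step 1: the `Z`-chart `y = y₀ + ε₁ ε Y`, `tₗ = t₀ + uₗ Y`
  ------------------------------------------------------------------
  set Mz : Fin 2 → Cf := ![RebaseZero.mk 1 0, RebaseZero.mk (-1) 1] with hMz
  set Az : Cf := RebaseZero.mk 0 αz with hAzdef
  set Bz : Cf := RebaseZero.mk 0 βz with hBzdef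
  have hAz : ∀ Y : ℝ, ev Az Y = αz := fun Y => by rw [hAzdef, ev_mk, Rat.cast_zero, zero_mul, zero_add]
  have hBz : ∀ Y : ℝ, ev Bz Y = βz := fun Y => by rw [hBzdef, ev_mk, Rat.cast_zero, zero_mul, zero_add]
  set R₁ := gDom 0 (n + 1) 2 Mz (clo Az) (chi Bz) with hR₁
  set f₁ : (Fin (0 + 1 + (n + 1)) → ℝ) → ℝ := fun w => ((ε₁ * q₀ : ℚ) : ℝ) *
    ((∏ l ∈ Finset.univ.erase k, 1 / tv w l) * (1 / (tv w k * yv w - c'))) with hf₁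
  set Ψ := zmap (k := n + 1) (sc : ℝ) (y₀ : ℝ) (t₀ : ℝ) with hΨ
  have mR₁ : ∀ w, w ∈ R₁ ↔ (0 < yv w ∧ yv w < 1) ∧ (αz : ℝ) < tv w 0 ∧ StrictMono (tv w) ∧
      tv w (Fin.last n) < βz := fun w => by
    rw [hR₁, mem_chain, mem_cellZ, hAz, hBz, Rat.cast_one]
  have htvΨ : ∀ w, tv (Ψ w) = fun l => (t₀ : ℝ) + tv w l * yv w := fun w => funext (tv_zmap _ _ _ w)
  have hyvΨ : ∀ w, yv (Ψ w) = y₀ + ε₁ * ε * yv w := fun w => by rw [hΨ, yv_zmap, hsc']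
  have hmem₁ : ∀ w, w ∈ R₁ ↔ Ψ w ∈ s.domain := fun w => by
    rw [mR₁, h.mem, htvΨ, hyvΨ, hcellI, hAv, hBv]
    have e1 : (ε₁ : ℝ) * (y₀ + ε₁ * ε * yv w - y₀) = ε * yv w := by linear_combination (ε * yv w) * hε2
    rw [e1]
    constructor
    · rintro ⟨⟨hY0, hY1⟩, h1, h2, h3⟩
      refine ⟨⟨mul_pos hεp hY0, by nlinarith⟩, by nlinarith, (strictMono_affine_iff hY0).2 h2, by nlinarith⟩
    · rintro ⟨⟨hY0, hY1⟩, h1, h2, h3⟩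
      have hY : 0 < yv w := pos_of_mul_pos_right hY0 hεp.le
      refine ⟨⟨hY, lt_of_mul_lt_mul_left (by linarith) hεp.le⟩, lt_of_mul_lt_mul_right ?_ hY.le,
        (strictMono_affine_iff hY).1 h2, lt_of_mul_lt_mul_right ?_ hY.le⟩ <;> nlinarith
  have hyne : ∀ z ∈ s.domain, (ε₁ : ℝ) * (yv z - y₀) ≠ 0 := fun z hz =>
    (((hcellI _).1 ((h.mem z).1 hz).1)).1.ne'
  have himg₁ : Ψ '' R₁ = s.domain := by
    ext z
    constructor
    · rintro ⟨w, hw, rfl⟩; exact (hmem₁ w).1 hw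
    · intro hz
      set W : ℝ := (ε₁ : ℝ) * (yv z - y₀) / ε with hW
      have hW0 : W ≠ 0 := div_ne_zero (hyne z hz) hεp.ne'
      set w : Fin (0 + 1 + (n + 1)) → ℝ := Fin.append (fun _ : Fin (0 + 1) => W)
        (fun l => (tv z l - t₀) / W) with hwdef
      have hyw : yv w = W := by simp only [yv, yIdx, hwdef, Fin.append_left]
      have htw : ∀ l, tv w l = (tv z l - t₀) / W := fun l => by simp only [tv, tIdx, hwdef, Fin.append_right]
      have hΨw : Ψ w = z := by
        refine ext_yv_tv ?_ fun l => ?_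
        · rw [hyvΨ, hyw, hW]
          field_simp
          linear_combination (yv z - y₀) * hε2
        · rw [tv_zmap, htw, hyw, div_mul_cancel₀ _ hW0]; ring
      exact ⟨w, (hmem₁ w).2 (by rw [hΨw]; exact hz), hΨw⟩
  -- the integrand through the `Z`-chart
  have hprodΨ : ∀ w, (∏ l ∈ Finset.univ.erase k, 1 / (tv (Ψ w) l - t₀)) * (1 / (tv (Ψ w) k - ck.2)) =
      (∏ l ∈ Finset.univ.erase k, 1 / (tv w l * yv w)) * (1 / (tv w k * yv w - c')) := by
    intro w
    congr 1
    · exact Finset.prod_congr rfl fun l _ => by rw [tv_zmap, add_sub_cancel_left]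
    · rw [tv_zmap, hc', Rat.cast_sub]
      congr 1
      ring
  have hS : ∀ w ∈ R₁, s.integrand (Ψ w) = (q₀ : ℝ) * (1 / ((ε₁ : ℝ) * ε * yv w)) *
      ((∏ l ∈ Finset.univ.erase k, 1 / (tv w l * yv w)) * (1 / (tv w k * yv w - c'))) := by
    intro w hw
    rw [h.int ((hmem₁ w).1 hw), glitB, glit_b0, h.n1, h.n2, pow_zero, pow_one, hp, hprodA, hprodΨ, hq₀', hyvΨ,
      add_sub_cancel_left]
  have hint₁ : ∀ w ∈ R₁, f₁ w = s.integrand (Ψ w) * |(zlin (sc : ℝ) w).det| := by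
    intro w hw
    have hY0 : 0 < yv w := ((mR₁ w).1 hw).1.1
    rw [zlin_det, hsc', abs_mul, abs_mul, hεa, one_mul, abs_of_pos hεp, abs_of_pos (pow_pos hY0 _), hS w hw,
      prod_erase_one_div_mul, rchart_powers hY0.ne' hεp.ne' hε2, hf₁, Rat.cast_mul]
  have hsaR₁ : IsSemialgebraic ℚ R₁ := isSemialgebraic_gDom _ _ _ _
  have hcoord : ∀ i : Fin (0 + 1 + (n + 1)), IsSemialgebraicFunOn ℚ R₁ fun w => w i := fun i =>
    (isSemialgebraicFunOn_aeval hsaR₁ (X i)).congr fun w _ => MvPolynomial.aeval_X w i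
  have hf₁sa : IsSemialgebraicFunOn ℚ R₁ f₁ := by
    refine IsSemialgebraicFunOn.mul_holds (isSemialgebraicFunOn_ratCast hsaR₁ _)
      (IsSemialgebraicFunOn.mul_holds (IntegrateOut.isSemialgebraicFunOn_finset_prod _ hsaR₁ fun l _ =>
        IntegrateOut.isSemialgebraicFunOn_div (isSemialgebraicFunOn_ratCast hsaR₁ 1 |>.congr fun w _ => by simp)
          (hcoord (tIdx l))) (IntegrateOut.isSemialgebraicFunOn_div
        (isSemialgebraicFunOn_ratCast hsaR₁ 1 |>.congr fun w _ => by simp) ?_))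
    exact (isSemialgebraicFunOn_aeval hsaR₁ (X (tIdx k) * X (yIdx (n + 1)) - MvPolynomial.C c')).congr
      fun w _ => by simp [tv, yv]
  obtain ⟨s₁, hs₁d, hs₁i, hrel₁⟩ := cov_pull s hsaR₁ Ψ (zlin (sc : ℝ))
    (by rw [hΨ]; exact isSemialgebraicMapOn_zmap sc y₀ t₀ hsaR₁)
    (fun w _ => (hasFDerivAt_zmap _ _ _ w).hasFDerivWithinAt)
    (zmap_injOn _ _ _ hsc0 fun w hw => ((mR₁ w).1 hw).1.1.ne') himg₁ f₁ hf₁sa hint₁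
  ------------------------------------------------------------------
  -- Step 2: swap the base `Y` with the fibre `u_k`
  ------------------------------------------------------------------
  set s₂ := s₁.reindex (swapIdx k) with hs₂
  have hrel₂ : KZ.of s₁ - KZ.of s₂ ∈ KZ.relations := KZ.of_sub_of_reindex_mem_relations s₁ (swapIdx k)
  have hmem₂ : ∀ v, v ∈ s₂.domain ↔ (fun i => v (swapIdx k i)) ∈ R₁ := fun v => by
    rw [hs₂, KZ.IntegralRep.reindex_domain, hs₁d]; rfl
  have mD₂ : ∀ v, v ∈ s₂.domain ↔ (0 < tv v k ∧ tv v k < 1) ∧ (αz : ℝ) < xv k v 0 ∧ StrictMono (xv k v) ∧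
      xv k v (Fin.last n) < βz := fun v => by
    rw [hmem₂, mR₁, yv_swapIdx, tv_swapIdx_eq_xv]
  have hint₂ : ∀ v, s₂.integrand v = ((ε₁ * q₀ : ℚ) : ℝ) *
      ((∏ l ∈ Finset.univ.erase k, 1 / tv v l) * (1 / (yv v * tv v k - c'))) := fun v => by
    rw [hs₂, KZ.IntegralRep.reindex_integrand, hs₁i]
    show f₁ (fun i => v (swapIdx k i)) = _
    rw [hf₁]
    dsimp only
    rw [tv_swapIdx_self, yv_swapIdx, Finset.prod_congr rfl fun l hl => by
      rw [tv_swapIdx_of_ne k v (Finset.ne_of_mem_erase hl)]]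
  -- positivity of the new base on the domain
  have hbpos : ∀ v ∈ s₂.domain, (αz : ℝ) < yv v ∧ yv v < βz := fun v hv => by
    obtain ⟨-, h0, hmono, hn⟩ := (mD₂ v).1 hv
    have hk0 : xv k v 0 ≤ xv k v k := hmono.monotone (Fin.zero_le _)
    have hkn : xv k v k ≤ xv k v (Fin.last n) := hmono.monotone (Fin.le_last _)
    rw [show xv k v k = yv v from if_pos rfl] at hk0 hkn
    exact ⟨h0.trans_le hk0, hkn.trans_lt hn⟩
  ------------------------------------------------------------------
  -- Step 3: the fibre blow-up `Z = b Y` (push-forward)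
  ------------------------------------------------------------------
  set Φ₃ := fibBlow k ((0 : ℚ) : ℝ) ((0 : ℚ) : ℝ) ((0 : ℚ) : ℝ) with hΦ₃
  have hΦ₃k : ∀ v, tv (Φ₃ v) k = tv v k * yv v := fun v => by
    rw [hΦ₃, fibBlow_self, Rat.cast_zero, zero_mul, zero_add, zero_add, sub_zero]
  set Mf : Fin 2 → Cf := ![RebaseZero.mk 1 (-αz), RebaseZero.mk (-1) βz] with hMf
  set R₃ := gDom 0 (n + 1) 2 Mf (rlo k Az) (rhi k Bz) with hR₃
  have mR₃ : ∀ z, z ∈ R₃ ↔ ((αz : ℝ) < yv z ∧ yv z < βz) ∧ (0 < tv z k ∧ tv z k < yv z) ∧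
      ((αz : ℝ) < xv k z 0 ∧ StrictMono (xv k z) ∧ xv k z (Fin.last n) < βz) := fun z => by
    rw [hR₃, mem_rDom_iff k Mf Az Bz rfl rfl (fun y hy => ?_) (fun y hy => ?_), mem_cellR, hAz, hBz]
    · rw [hAz]; exact ((mem_cellR αz βz y).1 hy).1
    · rw [hBz]; exact ((mem_cellR αz βz y).1 hy).2
  have hmem₃ : ∀ v ∈ s₂.domain, Φ₃ v ∈ R₃ := fun v hv => by
    obtain ⟨⟨hZ0, hZ1⟩, hchain⟩ := (mD₂ v).1 hv
    obtain ⟨hb0, hb1⟩ := hbpos v hv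
    have hb : 0 < yv v := hαz0'.trans hb0
    rw [mR₃, hΦ₃, yv_fibBlow, xv_fibBlow, ← hΦ₃, hΦ₃k]
    exact ⟨⟨hb0, hb1⟩, ⟨mul_pos hZ0 hb, by nlinarith⟩, hchain⟩
  have himg₃ : Φ₃ '' s₂.domain = R₃ := by
    ext z
    constructor
    · rintro ⟨v, hv, rfl⟩; exact hmem₃ v hv
    · intro hz
      obtain ⟨⟨hb0, hb1⟩, ⟨hZ0, hZb⟩, hchain⟩ := (mR₃ z).1 hz
      have hb : 0 < yv z := hαz0'.trans hb0
      set v := Function.update z (tIdx k) (tv z k / yv z) with hv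
      have hvy : yv v = yv z := yv_update _ _ _
      have hvk : tv v k = tv z k / yv z := tv_update_self _ _ _
      have hΦv : Φ₃ v = z := by
        funext i
        by_cases hi : i = tIdx k
        · rw [hi]
          show tv (Φ₃ v) k = tv z k
          rw [hΦ₃k, hvy, hvk, div_mul_cancel₀ _ hb.ne']
        · rw [hΦ₃, fibBlow_of_ne _ _ _ _ _ hi, hv, Function.update_of_ne hi]
      refine ⟨v, (mD₂ v).2 ⟨?_, ?_⟩, hΦv⟩
      · rw [hvk]
        exact ⟨div_pos hZ0 hb, (div_lt_one hb).2 hZb⟩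
      · rw [hv, xv_update]; exact hchain
  -- the literal integrand on the radial pattern
  set T' : BData := ⟨T.m, T.L, T.e, 0, 0, 0, 1⟩ with hT'
  set p' : MvPolynomial (Fin 0) ℚ := MvPolynomial.C ε₁ * p with hp'
  set a' : Fin (n + 1) → Option Cf := fun l =>
    if l = k then some (RebaseZero.mk 0 c') else some (RebaseZero.mk 0 0) with ha'
  have ha'0 : ∀ l d, a' l = some d → d.1 (Fin.last 0) = 0 := fun l d hd => by
    simp only [ha'] at hd
    split_ifs at hd <;> cases hd <;> rfl
  set f₃ := glitB T' p' a' with hf₃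
  have hprodA' : ∀ z : Fin (0 + 1 + (n + 1)) → ℝ, ∏ l, (a' l).elim (1 : ℝ) (fun c => 1 / (tv z l - ev c (yv z))) =
      (∏ l ∈ Finset.univ.erase k, 1 / tv z l) * (1 / (tv z k - c')) := by
    intro z
    rw [prod_eq_erase_mul k]
    congr 1
    · refine Finset.prod_congr rfl fun l hl => ?_
      rw [show a' l = some (RebaseZero.mk 0 0) from if_neg (Finset.ne_of_mem_erase hl), Option.elim_some, ev_mk]
      simp
    · rw [show a' k = some (RebaseZero.mk 0 c') from if_pos rfl, Option.elim_some, ev_mk]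
      simp
  have hF₃ : ∀ z, f₃ z = ((ε₁ * q₀ : ℚ) : ℝ) * (1 / yv z) *
      ((∏ l ∈ Finset.univ.erase k, 1 / tv z l) * (1 / (tv z k - c'))) := fun z => by
    rw [hf₃, glitB, glit_b0, hprodA']
    simp only [hT', hp', MvPolynomial.coeff_C_mul, pow_zero, pow_one, Prod.snd_zero, Rat.cast_zero, sub_zero,
      Rat.cast_mul, hq₀']
    ring
  have hprod₃ : ∀ v, ∏ l ∈ Finset.univ.erase k, 1 / tv (Φ₃ v) l = ∏ l ∈ Finset.univ.erase k, 1 / tv v l :=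
    fun v => Finset.prod_congr rfl fun l hl => by
      rw [hΦ₃, tv_fibBlow_of_ne _ _ _ _ _ (Finset.ne_of_mem_erase hl)]
  have hyΦ₃ : ∀ v, yv (Φ₃ v) = yv v := fun v => by rw [hΦ₃, yv_fibBlow]
  have hint₃ : ∀ v ∈ s₂.domain, s₂.integrand v =
      f₃ (Φ₃ v) * |(fibBlowL k ((0 : ℚ) : ℝ) ((0 : ℚ) : ℝ) v).det| := by
    intro v hv
    have hb : 0 < yv v := hαz0'.trans (hbpos v hv).1
    have hb' : yv v ≠ 0 := hb.ne'
    rw [det_fibBlowL, Rat.cast_zero, sub_zero, abs_of_pos hb, hint₂, hF₃, hyΦ₃, hΦ₃k, hprod₃,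
      mul_comm (yv v) (tv v k)]
    field_simp
  have hsaR₃ : IsSemialgebraic ℚ R₃ := isSemialgebraic_gDom _ _ _ _
  obtain ⟨s₃, hs₃d, hs₃i, hrel₃⟩ := cov_push s₂ Φ₃ (fibBlowL k ((0 : ℚ) : ℝ) ((0 : ℚ) : ℝ))
    (isSemialgebraicMapOn_fibBlow k 0 0 0 s₂.isSemialgebraic_domain)
    (fun v _ => (hasFDerivAt_fibBlow _ _ _ _ v).hasFDerivWithinAt)
    (fibBlow_injOn _ _ _ _ fun v hv => by
      rw [Rat.cast_zero]; exact (hαz0'.trans (hbpos v hv).1).ne') hsaR₃ himg₃ f₃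
    (isSemialgebraicFunOn_glit hsaR₃ _ _ _ _ _ _ _ _) hint₃
  ------------------------------------------------------------------
  -- Step 4: the output is literally in `GG 0 2 (n + 1)`
  ------------------------------------------------------------------
  have hbdd₃ : Bornology.IsBounded R₃ := by
    refine IntegrateOutLow.isBounded_of_forall_abs_le (βz : ℝ) fun z hz i => ?_
    obtain ⟨⟨hb0, hb1⟩, ⟨hZ0, hZb⟩, h0, hmono, hn⟩ := (mR₃ z).1 hz
    rcases idx_cases i with rfl | ⟨l, rfl⟩
    · show |yv z| ≤ βz
      rw [abs_of_pos (hαz0'.trans hb0)]; exact hb1.le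
    · show |tv z l| ≤ βz
      by_cases hl : l = k
      · subst hl; rw [abs_of_pos hZ0]; linarith
      · have hx : xv k z l = tv z l := if_neg hl
        have h1 : xv k z 0 ≤ xv k z l := hmono.monotone (Fin.zero_le _)
        have h2 : xv k z l ≤ xv k z (Fin.last n) := hmono.monotone (Fin.le_last _)
        rw [← hx, abs_of_pos (hαz0'.trans (h0.trans_le h1))]
        linarith
  have hrel : KZ.of s - KZ.of s₃ ∈ KZ.relations := by
    have := add_mem (add_mem hrel₁ hrel₂) hrel₃
    rwa [sub_add_sub_cancel, sub_add_sub_cancel] at this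
  refine RebaseZero.good_of_sub_mem hrel (RebaseZero.good_of_mem (mem_GGset_two (n₁ := 0) (n₂ := 1) s₃ Mf
    T.L T.e p' 0 0 a' (rlo k Az) (rhi k Bz) (Or.inl rfl) ha'0 (fun l d hd => ?_) (by rw [hs₃d]; exact hbdd₃)
    hs₃d fun z _ => by rw [hs₃i]; rfl))
  rcases hd with hd | hd
  · rcases rlo_inr k hd with rfl | rfl | rfl
    · exact Or.inl rfl
    · exact Or.inl rfl
    · exact Or.inr mk_one_zero
  · rcases rhi_inr k hd with rfl | rfl
    · exact Or.inl rfl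
    · exact Or.inr mk_one_zero

end RebaseChain

/-- Registered support goal of this file (part of `rebaseSimpleZeroMany_common`): the radial
blow-up of a pinch configuration of a clean chain of `n + 1` fibres with every fibre lettered and
all letters but the one of the fibre `k` at the vertex lands in `GG 0 2 (n + 1)`
(`RebaseChain.IsChain.good_radial`). -/
theorem rebaseSimpleZeroMany_chainRadial (n m' : ℕ) (s : KZ.IntegralRep (0 + 1 + (n + 1))) (M : Fin m' → (Fin (0 + 1) → ℚ) × ℚ) (A Bd : (Fin (0 + 1) → ℚ) × ℚ) (T : RebaseZero.BData) (p : MvPolynomial (Fin 0) ℚ) (a : Fin (n + 1) → Option ((Fin (0 + 1) → ℚ) × ℚ)) (h : RebaseChain.IsChain s M A Bd T p a) (y₀ t₀ ε₁ ε : ℚ) (hε₁ : ε₁ = 1 ∨ ε₁ = -1) (hε : 0 < ε) (hcellI : ∀ y : ℝ, y ∈ RebaseZero.cell M ↔ 0 < (ε₁ : ℝ) * (y - y₀) ∧ (ε₁ : ℝ) * (y - y₀) < ε) (hA0 : A.1 (Fin.last 0) * y₀ + A.2 = t₀) (hB0 : Bd.1 (Fin.last 0) * y₀ + Bd.2 =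 t₀) (hα : 0 < ε₁ * A.1 (Fin.last 0)) (hp : T.ℓ₂.2 = y₀) (k : Fin (n + 1)) (ck : (Fin (0 + 1) → ℚ) × ℚ) (hk : a k = some ck) (hP : ∀ l, l ≠ k → ∃ c, a l = some c ∧ c.2 = t₀) : RebaseZero.Good (n + 1) (KZ.of s) :=
  RebaseChain.IsChain.good_radial k h y₀ t₀ ε₁ ε hε₁ hε hcellI hA0 hB0 hα hp hk hP

end Summit.KontsevichZagierPeriods.ArrangementNormalForm.JanusBands
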